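import Summits.HodgeConjecture.HodgeConjecture.Theses.PadicSemiregularLift

/-!
# `SemiregularSeedsOnAnchors` (stmt-HodgeConjecture-13941) · Negative · the Fermat-sextic slice certificate

Kernel-checked (computational: `native_decide` on plain `List ℕ` data) COMPLETE finite certificate of the
combinatorial half of the paper refutation of the informal crux `PadicSemiregularLift.SemiregularSeedsOnAnchors`
AS FILED (`Cruxes/SemiregularSeedsOnAnchors/KILL.md`, standing disprover cycle 3; independently re-verified and
completed in cycle 4, refuter-cdisprove-stmt-HodgeConjecture-13941-g4-0, 2026-08-16). Cycle 3 (`Disproof.lean`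
§H5) had checked the witness triples and a few membership facts and left the three EXHAUSTIVE ENUMERATIONS —
census of the isotypic coset, completeness of the invariant directions, confinement — to kit scripts
(`verify_kill.py`, `certify_slice.py`, job j012064); this file checks all of them (and re-checks the rest).
Nothing here asserts a Theses declaration; the item is informal (no decl), so no `¬D` exists to land.

SETTING (paper; `KILL.md` §1). `p ≡ 5 (mod 6)`, `p ≫ 0`; `X_k ⊂ ℙ⁵` the Fermat sextic fourfold (Calabi–Yau,
Shioda–Katsura supersingular: an anchor for every `W`-lift); characters of `G = μ₆⁶/μ₆` are `x ∈ (ℤ/6)⁶`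
(`Σ xᵢ = 0`); the Jacobian ring `R = k[x₀..x₅]/(xᵢ⁵)` has monomial bases `R₆ ≅ H¹(T_X)` (exponent vectors
`γ ∈ [0,4]⁶`, `|γ| = 6`) and `R₁₂ ≅ H^{2,2}_prim` (`β ∈ [0,4]⁶`, `|β| = 12`); `x^ν` has character
`ν + (1,…,1) (mod 6)`, of Hodge type `(4 − q, q)` with `q + 1 = Σ(νᵢ + 1)/6`. `Λ₁ ⊂ (ℤ/6)⁶` is the subgroup
cut out by the five characters `killForms` (generated by `(0,4,2,0,0,0), (3,1,0,0,2,0), (2,0,0,0,0,4),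
(1,1,0,2,2,0)`; order `162`); `D = Λ₁ ∩ R₆` the 23 monomial directions of the `Λ₁^⊥`-invariant sextic family
`𝓕_D/W`; the class is the unsaturated pair `π = {a, −a}`, `a = (1,1,4,4,4,4) ∈ Λ₁`, realised in `R₁₂` by
`b = (0,0,3,3,3,3)` (`b + 𝟙 = a`) and `b' = 4 − b = (4,4,1,1,1,1)` (`b' + 𝟙 = −a`).

ENCODING. Vectors are `List ℕ` of length 6 (`V`); characters have entries in `[0,5]`, exponent vectors in
`[0,4]`; `vecs n` enumerates `[0,n)⁶` (`mem_vecs`, proved, is its specification); all arithmetic is in `ℕ`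
with `% 6` where a congruence is meant. (The `Fin 6 → Fin 6` / `![…]` encoding of `Disproof.lean` §H5 is
semantically identical but evaluates ~10⁵× slower on the farm; hence lists.)

WHAT IS CERTIFIED (everything finite in `KILL.md` §2):
* (C0) `Λ₁` has order `162`, lies in `{Σ xᵢ ≡ 0}`, contains the four generators and `a, 2a, 4a, −a`, and not
  `(0,0,3,3,3,3)`, `(4,4,1,1,1,1)`, `(2,2,5,5,5,5)` (`card_lam`, `lam_sum_zero`, `lam_class_data`); it is a
  subgroup (kernel of characters; `inLam_add` for the `+`-closure actually used: `a + Λ₁ = Λ₁`);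
* (C1/C2) CENSUS of the isotypic coset `a + Λ₁ = Λ₁`: `20` admissible characters (no zero entry), `18` of type
  `(2,2)`, exactly ONE of type `(3,1)` (`2a = (2,…,2)`), exactly ONE of type `(1,3)` (`4a = (4,…,4)`), NONE of
  type `(4,0)`/`(0,4)` (`lam_census`) — so the isotypic flat subbundle is self-dual with `rk F³ = 1`, `F⁴ = 0`:
  the `p`-adic Hodge locus `Z` of the pair class inside `𝓕_D` is ONE equation;
* (C0) COMPLETENESS: the degree-6 exponent vectors `γ ≤ 4` lying in `Λ₁` are EXACTLY the 23 listed directions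
  (`killD_complete`); `killDfree = killD ∖ {(3,3,0,0,0,0)}` (`killDfree_spec`);
* (C2) the linear part of the equation of `Z` is supported on the single direction `(3,3,0,0,0,0)` — the only
  `γ ∈ D` with `γ + 𝟙 ∈ {b, b'}` (`kill_equation_direction`); so `Z` is smooth, `dim 22`,
  `T₀Z = {ξ_{(3,3,0,0,0,0)} = 0}` is spanned by the 22 FREE directions;
* (C3) CONFINEMENT: exactly `48` monomials `β ∈ R₁₂` survive all free directions (`β + γ ≰ 4`), and the
  survivors whose partner `4 − β` also survives are EXACTLY `b, c, c', b'`, `c = (0,4,1,3,1,3)`,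
  `c' = (4,0,3,1,3,1)` (`kill_confinement`);
* (C4) the three WITNESS TRIPLES of the second-order obstruction for the supports `{b,b'}`, `{b,b',c,c'}`,
  `{c,c'}` (`kill_witnesses`), the sizes `314 / 244 / 318` of the monomial tangent spaces and the NUMBER of
  available witness triples per case (`kill_witness_counts`: the certificate does not hinge on the three
  displayed ones), and the non-vanishing of the Griffiths–Dwork constants for `p ≥ 11`;
* (cycle 4, new) a SECOND INDEPENDENT SLICE `Λ₂` (last section): order `162`, census `22/2/2/0` (two equations with
  independent linear parts on `(0,0,2,2,2,0)` and `(3,3,0,0,0,0)`), `|D₂| = 25`, `dim Z₂ = 23`, confinement `59` survivors with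
  paired part EXACTLY `{b, b'}` — there only cases 2 and 4 of the analysis occur, so the refutation does not depend on the
  `{c, c'}` bookkeeping of the first slice at all.

WHAT STAYS ON PAPER (`KILL.md` §3–§5; re-verified line by line in cycle 4, `Disproof.lean` §H6 / `KILL-REVIEW.md`):
(F1) `σ = σ₁ = evᵗ` on the CY sextic; (F2) order-two lifting of a semiregular `E` over `ker ev` inside the
formal Hodge locus (Illusie torsor + `ev` onto; crystalline Chern classes horizontal, PD-orders `< p`);
(F3) the Griffiths–Dwork second-order forms `Q_ρ(ξ) = 3·C₃(ρξξ)` (control-validated on the plane class);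
(F4) Mazur–Ogus visibility / pairing of supports; (F5) rigidity of the all-invisible case; (H1–H4) Hodge origin
of `α = bo_y(u)`; (K1–K3) confinement at a very general `y ∈ Z(W)` and the four-case contradiction. The cycle
`𝒵` with `e_π[𝒵] ≠ 0` exists by Shioda's inductive structure alone (`a ~ (1,4,4,3) ∗ (1,4,4,3)` from two
`(1,1)`-characters of the Fermat sextic SURFACE, algebraic by Lefschetz) — the Hodge conjecture for `X⁴₆` is
not needed.

SCOPE (cycle-4 classification note for the planner's repair). The witness anchor `𝒳_y` is a very general point
of a Hodge-locus slice through a supersingular CM point of FERMAT type — an anchor of the filed definition (and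
of the kind the route wants for `HodgeBeyondAnchors`), but not one the Assembly consumes for its two typed
outputs (`HodgeFermatVarieties`: the Fermat lift `X^n_m ⊗ W` itself; `HodgeAbelianVarieties`: ABELIAN-SCHEME
anchors). The repair `C′` = "P2a with anchors restricted to abelian schemes over `W` and to the Fermat lifts
themselves" is NOT bitten by this witness (no confinement at the Fermat lift; for abelian schemes special
subvarieties are smooth and `HT² ≠ H¹(T)`), and is the crux's genuine open content.
-/

set_option linter.dupNamespace false

namespace Summit.HodgeConjecture.HodgeConjecture.Theorems.SemiregularSeedsOnAnchors.Negative.SexticSlice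

/-! ## Encoding -/

/-- Vectors: lists of naturals (length 6 throughout). -/
abbrev V := List ℕ

/-- `[0,n)⁶` in lexicographic order. -/
def vecs (n : ℕ) : List V :=
  (List.range n).flatMap fun a => (List.range n).flatMap fun b => (List.range n).flatMap fun c =>
    (List.range n).flatMap fun d => (List.range n).flatMap fun e =>
      (List.range n).map fun f => [a, b, c, d, e, f]

/-- Specification of the enumeration. -/
theorem mem_vecs {n : ℕ} {x : V} :
    x ∈ vecs n ↔ ∃ a b c d e f, x = [a, b, c, d, e, f] ∧ a < n ∧ b < n ∧ c < n ∧ d < n ∧ e < n ∧ f < n := by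
  simp only [vecs, List.mem_flatMap, List.mem_range, List.mem_map]
  constructor
  · rintro ⟨a, ha, b, hb, c, hc, d, hd, e, he, f, hf, rfl⟩
    exact ⟨a, b, c, d, e, f, rfl, ha, hb, hc, hd, he, hf⟩
  · rintro ⟨a, b, c, d, e, f, rfl, ha, hb, hc, hd, he, hf⟩
    exact ⟨a, ha, b, hb, c, hc, d, hd, e, he, f, hf, rfl⟩

/-- Every length-6 list with entries `< n` is enumerated. -/
theorem mem_vecs_of_forall_lt {n : ℕ} {x : V} (hlen : x.length = 6) (hlt : ∀ t ∈ x, t < n) : x ∈ vecs n := by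
  match x, hlen with
  | [a, b, c, d, e, f], _ =>
    simp only [List.mem_cons, List.not_mem_nil, or_false, forall_eq_or_imp, forall_eq] at hlt
    obtain ⟨ha, hb, hc, hd, he, hf⟩ := hlt
    exact mem_vecs.2 ⟨a, b, c, d, e, f, rfl, ha, hb, hc, hd, he, hf⟩

/-- `Σ wᵢ xᵢ` (the pairing, to be read mod 6). -/
def dot6 (w x : V) : ℕ := (List.zipWith (· * ·) w x).sum

/-- Componentwise sum. -/
def vadd (x y : V) : V := List.zipWith (· + ·) x y

/-- Coordinate sum (degree of a monomial; `6(q+1)` for an admissible character of type `(4−q,q)`). -/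
def vsum (x : V) : ℕ := x.sum

/-! ## The subgroup `Λ₁ ⊂ (ℤ/6)⁶` -/

/-- The five characters cutting out `Λ₁` (double annihilator of the four generators of `KILL.md`). -/
def killForms : List V :=
  [[0, 2, 2, 0, 5, 0], [2, 0, 0, 2, 0, 5], [0, 0, 0, 3, 0, 0], [0, 0, 3, 0, 0, 0], [3, 3, 0, 0, 0, 0]]

/-- Membership in `Λ₁` for a vector with entries in `[0,5]` (or any representative: only residues mod 6 matter). -/
def inLam (x : V) : Bool := killForms.all fun w => dot6 w x % 6 == 0

/-- Admissible character: no zero entry (mod 6). -/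
def admissible (x : V) : Bool := x.all fun t => t % 6 != 0

/-- (C0) `|Λ₁| = 162`, and `Λ₁ ⊂ {Σ xᵢ ≡ 0 (mod 6)}` (every element is a character of `μ₆⁶/μ₆`). -/
theorem card_lam :
    ((vecs 6).filter inLam).length = 162 ∧ (vecs 6).length = 46656 ∧
    ((vecs 6).filter inLam).all (fun x => vsum x % 6 == 0) = true := by
  native_decide

/-- `Λ₁` is closed under addition on `[0,5]⁶` (sum reduced mod 6): exhaustive over the `162 × 162` pairs.
(It is the kernel of five characters, hence a subgroup; this is the closure actually used: `a + Λ₁ = Λ₁`.) -/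
theorem inLam_add :
    (((vecs 6).filter inLam).all fun x => ((vecs 6).filter inLam).all fun y =>
      inLam ((vadd x y).map (· % 6))) = true := by
  native_decide

/-- (C1) Class data: the four generators, `a = (1,1,4,4,4,4)`, `2a = (2,…,2)` (`Σ = 12`: type `(3,1)`),
`4a = (4,…,4)` (`Σ = 24`: type `(1,3)`), `−a = (5,5,2,2,2,2)` lie in `Λ₁`; `b̄ = (0,0,3,3,3,3)`,
`b̄' = (4,4,1,1,1,1)`, `−b̄' = (2,2,5,5,5,5)` do NOT (their presence would put a `(4,0)`/`(0,4)` character into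
`±a + Λ₁`). -/
theorem lam_class_data :
    (inLam [0, 4, 2, 0, 0, 0] ∧ inLam [3, 1, 0, 0, 2, 0] ∧ inLam [2, 0, 0, 0, 0, 4] ∧ inLam [1, 1, 0, 2, 2, 0]) ∧
    (inLam [1, 1, 4, 4, 4, 4] ∧ inLam [2, 2, 2, 2, 2, 2] ∧ inLam [4, 4, 4, 4, 4, 4] ∧ inLam [5, 5, 2, 2, 2, 2]) ∧
    (vsum [1, 1, 4, 4, 4, 4] = 18 ∧ vsum [2, 2, 2, 2, 2, 2] = 12 ∧ vsum [4, 4, 4, 4, 4, 4] = 24) ∧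
    (inLam [0, 0, 3, 3, 3, 3] = false ∧ inLam [4, 4, 1, 1, 1, 1] = false ∧ inLam [2, 2, 5, 5, 5, 5] = false) := by
  native_decide

/-- (C1/C2) **CENSUS of the isotypic coset** `a + Λ₁ = Λ₁` (exhaustive over `(ℤ/6)⁶`): `20` admissible
characters; `18` of type `(2,2)` (`Σ = 18`); the ONLY one of type `(3,1)` (`Σ = 12`) is `2a`, the only one of
type `(1,3)` (`Σ = 24`) is `4a`; none of type `(4,0)` (`Σ = 6`) or `(0,4)` (`Σ = 30`). Hence the isotypic flat
subbundle `𝓦` has `rk F³𝓦 = 1`, `F⁴𝓦 = 0`, is self-dual (`−a ∈ Λ₁`), and the Hodge locus of the pair class in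
`𝓕_D` is ONE equation `f = ⟨u_t, ω^{(3,1)}_t⟩ = 0`. -/
theorem lam_census :
    ((vecs 6).filter fun x => inLam x && admissible x).length = 20 ∧
    ((vecs 6).filter fun x => inLam x && admissible x && vsum x == 18).length = 18 ∧
    ((vecs 6).filter fun x => inLam x && admissible x && vsum x == 12) = [[2, 2, 2, 2, 2, 2]] ∧
    ((vecs 6).filter fun x => inLam x && admissible x && vsum x == 24) = [[4, 4, 4, 4, 4, 4]] ∧
    ((vecs 6).filter fun x => inLam x && admissible x && vsum x == 6) = [] ∧
    ((vecs 6).filter fun x => inLam x && admissible x && vsum x == 30) = [] := by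
  native_decide

/-! ## The invariant directions `D = Λ₁ ∩ R₆` -/

/-- The 23 invariant directions `D = Λ₁ ∩ R₆` (degree-6 exponent vectors, entries `≤ 4`, in `Λ₁`), lex order. -/
def killD : List V :=
  [[0, 0, 0, 2, 0, 4], [0, 0, 0, 4, 0, 2], [0, 0, 2, 0, 4, 0], [0, 0, 4, 0, 2, 0], [0, 2, 0, 0, 4, 0],
   [0, 2, 2, 0, 2, 0], [0, 2, 4, 0, 0, 0], [0, 4, 0, 0, 2, 0], [0, 4, 2, 0, 0, 0], [1, 1, 0, 0, 2, 2],
   [1, 1, 0, 2, 2, 0], [1, 1, 2, 0, 0, 2], [1, 1, 2, 2, 0, 0], [1, 3, 0, 0, 0, 2], [1, 3, 0, 2, 0, 0],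
   [2, 0, 0, 0, 0, 4], [2, 0, 0, 2, 0, 2], [2, 0, 0, 4, 0, 0], [3, 1, 0, 0, 2, 0], [3, 1, 2, 0, 0, 0],
   [3, 3, 0, 0, 0, 0], [4, 0, 0, 0, 0, 2], [4, 0, 0, 2, 0, 0]]

/-- The 22 FREE directions: `D` minus the equation direction `(3,3,0,0,0,0)`. -/
def killDfree : List V :=
  [[0, 0, 0, 2, 0, 4], [0, 0, 0, 4, 0, 2], [0, 0, 2, 0, 4, 0], [0, 0, 4, 0, 2, 0], [0, 2, 0, 0, 4, 0],
   [0, 2, 2, 0, 2, 0], [0, 2, 4, 0, 0, 0], [0, 4, 0, 0, 2, 0], [0, 4, 2, 0, 0, 0], [1, 1, 0, 0, 2, 2],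
   [1, 1, 0, 2, 2, 0], [1, 1, 2, 0, 0, 2], [1, 1, 2, 2, 0, 0], [1, 3, 0, 0, 0, 2], [1, 3, 0, 2, 0, 0],
   [2, 0, 0, 0, 0, 4], [2, 0, 0, 2, 0, 2], [2, 0, 0, 4, 0, 0], [3, 1, 0, 0, 2, 0], [3, 1, 2, 0, 0, 0],
   [4, 0, 0, 0, 0, 2], [4, 0, 0, 2, 0, 0]]

/-- (C0) **COMPLETENESS of `D`** (exhaustive over `[0,4]⁶`): the degree-6 exponent vectors with entries `≤ 4`
lying in `Λ₁` are EXACTLY `killD` (as the lex-ordered sublist of the enumeration). -/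
theorem killD_complete :
    ((vecs 5).filter fun g => vsum g == 6 && inLam g) = killD ∧ killD.length = 23 ∧ killD.Nodup := by
  native_decide

/-- `killDfree` is `killD` with `(3,3,0,0,0,0)` removed. -/
theorem killDfree_spec :
    killDfree = killD.filter (fun g => g != [3, 3, 0, 0, 0, 0]) ∧ killDfree.length = 22 ∧
    [3, 3, 0, 0, 0, 0] ∈ killD ∧ [3, 3, 0, 0, 0, 0] ∉ killDfree := by
  native_decide

/-- (C2) **The equation direction** (exhaustive over `D`): the linear part of the single equation of `Z` at the
Fermat point, `ξ ↦ −2 Σ_γ ξ_γ ⟨u, [x^{γ+𝟙} Ω/F³]⟩`, sees `γ` only if `x^{γ+𝟙}` is a monomial of `R₁₂` (entries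
`≤ 4`) of character `∓a`, i.e. `γ + 𝟙 ∈ {b, b'}`; the only such `γ ∈ D` is `(3,3,0,0,0,0)` (`+ 𝟙 = b'`;
`b − 𝟙` has a negative entry). A `γ` with an entry `4` gives an exponent `5`, a monomial of the Jacobian ideal
whose Griffiths–Dwork carry has coefficient `(5−5)/12 = 0`. -/
theorem kill_equation_direction :
    (killD.filter fun γ => vadd γ [1, 1, 1, 1, 1, 1] == [4, 4, 1, 1, 1, 1] ||
        vadd γ [1, 1, 1, 1, 1, 1] == [0, 0, 3, 3, 3, 3]) = [[3, 3, 0, 0, 0, 0]] ∧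
    ((5 : ℚ) - 5) / 12 = 0 := by
  refine ⟨by native_decide, by norm_num⟩

/-! ## Confinement -/

/-- `b = (0,0,3,3,3,3)`, the `R₁₂`-monomial of character `a` (`b + 𝟙 = a`). -/
def bVec : V := [0, 0, 3, 3, 3, 3]
/-- `b' = 4 − b = (4,4,1,1,1,1)`, character `−a`. -/
def b'Vec : V := [4, 4, 1, 1, 1, 1]
/-- `c = (0,4,1,3,1,3)`, the extra paired survivor of the slice (a three-pair character `c + 𝟙`). -/
def cVec : V := [0, 4, 1, 3, 1, 3]
/-- `c' = 4 − c = (4,0,3,1,3,1)`. -/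
def c'Vec : V := [4, 0, 3, 1, 3, 1]

/-- The partner `4 − β` (dual character). -/
def partner (β : V) : V := β.map (4 - ·)

/-- `β ∈ R₁₂` SURVIVES the free directions: every free `γ` has `β + γ ≰ 4` (some entry `> 4`), i.e.
`x^γ · x^β = 0` in `R₁₈` for every free `γ`, so differentiating the Hodge condition along the free `W`-curves
of `Z` imposes nothing on the `β`-coefficient of a class. -/
def survives (β : V) : Bool := killDfree.all fun γ => (vadd β γ).any (4 < ·)

/-- (C3) **CONFINEMENT** (exhaustive over `[0,4]⁶`): exactly `48` monomials `β ∈ R₁₂` survive all 22 free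
directions, and the survivors whose partner `4 − β` also survives are EXACTLY `b, c, c', b'` (lex order).
With the Mazur–Ogus pairing of supports (F4) this confines the primitive Hodge polynomial of every rational class
staying Hodge along `Z` to `supp ⊆ {b, b'} ∪ {c, c'}`. -/
theorem kill_confinement :
    (((vecs 5).filter fun β => vsum β == 12).filter survives).length = 48 ∧
    (((vecs 5).filter fun β => vsum β == 12).filter fun β => survives β && survives (partner β)) =
      [bVec, cVec, c'Vec, b'Vec] ∧
    (partner bVec = b'Vec ∧ partner cVec = c'Vec ∧ vsum bVec = 12 ∧ vsum cVec = 12) ∧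
    ((vecs 5).filter fun β => vsum β == 12).length = 1751 := by
  native_decide

/-! ## The witness triples of the second-order obstruction -/

/-- `x^γ ∈ R₆` lies in the MONOMIAL part of the tangent space `T(P)` of the Hodge locus of a class whose
primitive support is `S` (paired): `x^γ · x^s = 0` in `R₁₈` for every `s ∈ S` (some entry of `γ + s` exceeds
`4`; supports being closed under `s ↦ 4 − s`, this is "γ divides no `x^{4−s}`"). -/
def inTangent (S : List V) (γ : V) : Bool :=
  (vsum γ == 6) && γ.all (· ≤ 4) && S.all fun s => (vadd γ s).any (4 < ·)

/-- `s + 6eᵢ`. -/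
def bump (s : V) (i : ℕ) : V := s.mapIdx fun j t => if j = i then t + 6 else t

/-- A WITNESS TRIPLE for the support `S` at the target `s + 6eᵢ` (`s ∈ S`, `sᵢ + 6 ∈ [5,10]` is automatic
for `sᵢ ≤ 4`): three tangent monomials whose honest product is `x^{s + 6eᵢ}` — one Griffiths–Dwork carry
(coefficient `(sᵢ + 1)/18 ≠ 0` for `p ≥ 11`) reduces it to the `(2,2)`-monomial `x^s`, so the trilinear
obstruction form takes the value `((sᵢ+1)/18)·c_v(s)` on the triple, non-zero when `s` is a VISIBLE element
of the support. -/
def isWitness (S : List V) (s : V) (i : ℕ) (γ₁ γ₂ γ₃ : V) : Bool :=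
  S.contains s && s.all (· ≤ 4) && (vsum s == 12) && inTangent S γ₁ && inTangent S γ₂ && inTangent S γ₃ &&
    (vadd (vadd γ₁ γ₂) γ₃ == bump s i)

/-- (C4) **THE THREE WITNESS TRIPLES** of the case analysis (`KILL.md` (C4)/(K3)):
case 2 (`S = {b,b'}`, both visible): `(1,0,0,0,2,3)+(1,0,1,3,1,0)+(4,0,2,0,0,0) = b + 6e₀`;
case 1 (`S = {b,b',c,c'}`): `(0,1,2,1,1,1)+(1,2,3,0,0,0)+(3,1,2,0,0,0) = b' + 6e₂`;
case 3 (`S = {c,c'}`): `(1,0,0,1,1,3)+(1,2,1,2,0,0)+(4,2,0,0,0,0) = c + 6e₀`. -/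
theorem kill_witnesses :
    isWitness [bVec, b'Vec] bVec 0 [1, 0, 0, 0, 2, 3] [1, 0, 1, 3, 1, 0] [4, 0, 2, 0, 0, 0] ∧
    isWitness [bVec, b'Vec, cVec, c'Vec] b'Vec 2 [0, 1, 2, 1, 1, 1] [1, 2, 3, 0, 0, 0] [3, 1, 2, 0, 0, 0] ∧
    isWitness [cVec, c'Vec] cVec 0 [1, 0, 0, 1, 1, 3] [1, 2, 1, 2, 0, 0] [4, 2, 0, 0, 0, 0] := by
  native_decide

/-- The number of witness triples `{γ₁ ≤ γ₂ ≤ γ₃} ⊂ T_S` (lex-ordered, with repetition) hitting `s + 6eᵢ`. -/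
def witnessCount (S : List V) (s : V) (i : ℕ) : ℕ :=
  let T := ((vecs 5).filter fun γ => vsum γ == 6).filter (inTangent S)
  (T.flatMap fun γ₁ => T.flatMap fun γ₂ => if γ₁ ≤ γ₂ then
      let γ₃ := (bump s i).zipWith (fun t u => t - u) (vadd γ₁ γ₂)
      if (vadd (vadd γ₁ γ₂) γ₃ == bump s i) && inTangent S γ₃ && decide (γ₂ ≤ γ₃) then [γ₃] else []
    else []).length

/-- (C4, robustness) Sizes of the monomial tangent spaces (`314`, `244`, `318` of the `426` monomials of `R₆`)
and the number of available witness triples at the displayed targets: `372` for `b + 6e₀` on `{b,b'}`, `35`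
for `b' + 6e₂` on `{b,b',c,c'}`, `621` for `c + 6e₀` on `{c,c'}` — any one suffices. -/
theorem kill_witness_counts :
    ((vecs 5).filter fun γ => vsum γ == 6).length = 426 ∧
    (((vecs 5).filter fun γ => vsum γ == 6).filter (inTangent [bVec, b'Vec])).length = 314 ∧
    (((vecs 5).filter fun γ => vsum γ == 6).filter (inTangent [bVec, b'Vec, cVec, c'Vec])).length = 244 ∧
    (((vecs 5).filter fun γ => vsum γ == 6).filter (inTangent [cVec, c'Vec])).length = 318 ∧
    witnessCount [bVec, b'Vec] bVec 0 = 372 ∧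
    witnessCount [bVec, b'Vec, cVec, c'Vec] b'Vec 2 = 35 ∧
    witnessCount [cVec, c'Vec] cVec 0 = 621 := by
  native_decide

/-- The Griffiths–Dwork constants of the carries used (`(νᵢ − 5)/(6q)` at pole order `q + 1 = 4`): `1/18` at
`νᵢ = 6`, `1/9` at `νᵢ = 7`, `0` at `νᵢ = 5` (consistency: such a monomial vanishes in primitive cohomology);
all are `p`-adic units for `p ≥ 11` (indeed for `p ≥ 5`). [folklore: Griffiths 1969] -/
theorem griffithsDwork_constants :
    (((6 : ℚ) - 5) / (6 * 3) = 1 / 18 ∧ ((7 : ℚ) - 5) / (6 * 3) = 1 / 9 ∧ ((5 : ℚ) - 5) / (6 * 3) = 0) ∧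
    (bVec.getD 0 0 + 6 = 6 ∧ b'Vec.getD 2 0 + 6 = 7 ∧ cVec.getD 0 0 + 6 = 6) ∧
    ∀ p : ℕ, p.Prime → 5 ≤ p → Nat.Coprime 18 p := by
  refine ⟨by norm_num, by decide, ?_⟩
  intro p hp hp5
  have h2 : ¬ p ∣ 2 := fun h => by have := Nat.le_of_dvd (by norm_num) h; omega
  have h3 : ¬ p ∣ 3 := fun h => by have := Nat.le_of_dvd (by norm_num) h; omega
  have : Nat.Coprime p 18 := by
    rw [show (18 : ℕ) = 2 * 3 ^ 2 by norm_num]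
    exact Nat.Coprime.mul_right ((Nat.Prime.coprime_iff_not_dvd hp).2 h2)
      (Nat.Coprime.pow_right 2 ((Nat.Prime.coprime_iff_not_dvd hp).2 h3))
  exact this.symm

/-! ## A second, independent slice `Λ₂` (cycle 4): paired survivors `{b, b'}` only

`KILL.md` (C4) names a second subgroup `Λ₂ = ⟨(2,0,2,2,0,0), (0,0,0,2,4,0), (1,3,0,0,2,0), (0,2,0,2,0,2)⟩` (order `162`,
`a ∈ Λ₂`). Its isotypic coset has census `22 × (2,2)`, `2 × (3,1)` (`(1,1,2,2,2,4)` and `2a`), `2 × (1,3)`, `0 × (4,0)/(0,4)`, so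
the Hodge locus `Z₂` of `u` in the 25-parameter family `𝓕_{D₂}` is cut out by TWO equations, whose linear parts live on the two
distinct directions `(0,0,2,2,2,0)` (`+ (0,0,1,1,1,3) = b`) and `(3,3,0,0,0,0)` (`+ 𝟙 = b'`) with coefficients `∝ u_{∓a} ≠ 0`:
`Z₂` is smooth of dimension `23` with 23 free coordinate directions, and confinement along them leaves `59` survivors whose
paired part is EXACTLY `{b, b'}`. At a very general point of `Z₂(W)` the case analysis of `KILL.md` (K3) therefore has only
case 2 (visible: the `{b,b'}` witness triple of `kill_witnesses`) and case 4 (invisible: rigidity) — the pair `{c, c'}` and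
cases 1, 3 never arise. This is a second refutation instance independent of the `Λ₁` confinement census. -/

/-- `Λ₂` presented as the kernel of characters: ALL `w ∈ (ℤ/6)⁶` annihilating its four generators (the annihilator, `288`
of them, plus a harmless `0`); the double annihilator is checked below to have order `162` and to contain the generators. -/
def killForms₂ : List V :=
  [[0, 0, 0, 0, 0, 0]] ++ ((vecs 6).filter fun w =>
    [[2, 0, 2, 2, 0, 0], [0, 0, 0, 2, 4, 0], [1, 3, 0, 0, 2, 0], [0, 2, 0, 2, 0, 2]].all fun g => dot6 w g % 6 == 0)

/-- Membership in `Λ₂` = annihilated by every character that annihilates the four generators. -/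
def inLam₂ (x : V) : Bool := killForms₂.all fun w => dot6 w x % 6 == 0

/-- (Λ₂-C0/C1) `|Λ₂| = 162` (so the double annihilator IS the subgroup generated: it contains the generators and
`|Λ₂^⊥| · |Λ₂| = 6⁶/…` — concretely the annihilator has `288 = 46656/162` elements), the generators and `a, −a, 2a` lie in it. -/
theorem card_lam₂ :
    ((vecs 6).filter inLam₂).length = 162 ∧ killForms₂.length = 288 + 1 ∧ 288 * 162 = 46656 ∧
    (inLam₂ [2, 0, 2, 2, 0, 0] ∧ inLam₂ [0, 0, 0, 2, 4, 0] ∧ inLam₂ [1, 3, 0, 0, 2, 0] ∧ inLam₂ [0, 2, 0, 2, 0, 2]) ∧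
    (inLam₂ [1, 1, 4, 4, 4, 4] ∧ inLam₂ [5, 5, 2, 2, 2, 2] ∧ inLam₂ [2, 2, 2, 2, 2, 2]) := by
  native_decide

/-- (Λ₂-C2) CENSUS of the isotypic coset `a + Λ₂ = Λ₂`: `26` admissible characters, `22` of type `(2,2)`, the `(3,1)` ones are
EXACTLY `(1,1,2,2,2,4)` and `(2,2,2,2,2,2)`, the `(1,3)` ones exactly `(4,…,4)` and `(5,5,4,4,4,2)`, none of type `(4,0)/(0,4)`:
TWO equations. -/
theorem lam₂_census :
    ((vecs 6).filter fun x => inLam₂ x && admissible x).length = 26 ∧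
    ((vecs 6).filter fun x => inLam₂ x && admissible x && vsum x == 18).length = 22 ∧
    ((vecs 6).filter fun x => inLam₂ x && admissible x && vsum x == 12) = [[1, 1, 2, 2, 2, 4], [2, 2, 2, 2, 2, 2]] ∧
    ((vecs 6).filter fun x => inLam₂ x && admissible x && vsum x == 24) = [[4, 4, 4, 4, 4, 4], [5, 5, 4, 4, 4, 2]] ∧
    ((vecs 6).filter fun x => inLam₂ x && admissible x && vsum x == 6) = [] ∧
    ((vecs 6).filter fun x => inLam₂ x && admissible x && vsum x == 30) = [] := by
  native_decide

/-- The 25 invariant directions `D₂ = Λ₂ ∩ R₆` (lex order). -/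
def killD₂ : List V :=
  [[0, 0, 0, 2, 4, 0], [0, 0, 0, 4, 2, 0], [0, 0, 2, 0, 4, 0], [0, 0, 2, 2, 2, 0], [0, 0, 2, 4, 0, 0],
   [0, 0, 4, 0, 2, 0], [0, 0, 4, 2, 0, 0], [0, 2, 0, 0, 2, 2], [0, 2, 0, 2, 0, 2], [0, 2, 2, 0, 0, 2],
   [1, 1, 0, 0, 0, 4], [1, 3, 0, 0, 2, 0], [1, 3, 0, 2, 0, 0], [1, 3, 2, 0, 0, 0], [2, 0, 0, 0, 4, 0],
   [2, 0, 0, 2, 2, 0], [2, 0, 0, 4, 0, 0], [2, 0, 2, 0, 2, 0], [2, 0, 2, 2, 0, 0], [2, 0, 4, 0, 0, 0],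
   [2, 2, 0, 0, 0, 2], [3, 3, 0, 0, 0, 0], [4, 0, 0, 0, 2, 0], [4, 0, 0, 2, 0, 0], [4, 0, 2, 0, 0, 0]]

/-- The 23 free directions of `Z₂`: `D₂` minus the two equation directions. -/
def killD₂free : List V := killD₂.filter fun g => g != [0, 0, 2, 2, 2, 0] && g != [3, 3, 0, 0, 0, 0]

/-- (Λ₂-C0/C2) COMPLETENESS of `D₂` and the TWO EQUATION DIRECTIONS: the `(3,1)`-monomials of the dual coset are
`A₁ = (0,0,1,1,1,3)` and `A₂ = 𝟙`; the only `γ ∈ D₂` with `γ + A_j ∈ {b, b'}` are `(0,0,2,2,2,0)` (for `A₁`, giving `b`) and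
`(3,3,0,0,0,0)` (for `A₂`, giving `b'`) — distinct coordinates, so the two linear parts are independent and `Z₂` is smooth of
dimension `25 − 2 = 23`. -/
theorem killD₂_complete :
    ((vecs 5).filter fun g => vsum g == 6 && inLam₂ g) = killD₂ ∧ killD₂.length = 25 ∧ killD₂free.length = 23 ∧
    (killD₂.filter fun γ => vadd γ [0, 0, 1, 1, 1, 3] == bVec || vadd γ [0, 0, 1, 1, 1, 3] == b'Vec) = [[0, 0, 2, 2, 2, 0]] ∧
    (killD₂.filter fun γ => vadd γ [1, 1, 1, 1, 1, 1] == bVec || vadd γ [1, 1, 1, 1, 1, 1] == b'Vec) = [[3, 3, 0, 0, 0, 0]] ∧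
    (vadd [0, 0, 1, 1, 1, 3] [1, 1, 1, 1, 1, 1]).map (· % 6) = [1, 1, 2, 2, 2, 4] ∧ 25 - 2 = 23 := by
  native_decide

/-- Survival w.r.t. the 23 free directions of `Z₂`. -/
def survives₂ (β : V) : Bool := killD₂free.all fun γ => (vadd β γ).any (4 < ·)

/-- (Λ₂-C3) CONFINEMENT on the second slice: `59` survivors, paired survivors EXACTLY `{b, b'}` — so at a very general point of
`Z₂(W)` every seed class has primitive support `⊆ {b, b'}` and only cases 2 and 4 of the four-case analysis occur; case 2 dies by
the `{b,b'}` witness of `kill_witnesses`, case 4 by rigidity. -/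
theorem kill_confinement₂ :
    (((vecs 5).filter fun β => vsum β == 12).filter survives₂).length = 59 ∧
    (((vecs 5).filter fun β => vsum β == 12).filter fun β => survives₂ β && survives₂ (partner β)) = [bVec, b'Vec] := by
  native_decide

end Summit.HodgeConjecture.HodgeConjecture.Theorems.SemiregularSeedsOnAnchors.Negative.SexticSlice
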